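import Literature.NumberTheory.GaloisRepresentations.SUnitsCoinducedLayerPresentation
import Literature.NumberTheory.GaloisRepresentations.RestrictedRamificationCycCapLayers
import Literature.NumberTheory.GaloisRepresentations.SUnitsRestrictedCohomologyDegreeTwoTorsionUpper
import Literature.RepresentationTheory.FiniteGroups.PermutationFunctionsModPSumZero
import HarnessLib

/-!
# `ψ(𝓗²(E_S)[p]) + ψ(ℤ/p) = ψ(ℤ[S(E)]/p)` — the `Δ`-class of `𝓗²(E_S)[p]` from a layer presentation
# (NSW (8.3.11): `H²(G_S, 𝒪_S^×)(p) ≅ ker(⊕_{v∈S} ℚ_p/ℤ_p →Σ ℚ_p/ℤ_p)`, equivariantly; Milne ADT I §5, proof of Thm. 5.1)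

Topic `NumberTheory/GaloisRepresentations`; namespace `Literature.NumberTheory.GaloisRepresentations.SUnits.Layers`.
THEOREMS ONLY (no definition, no named fact, no `sorry`, no instance; D-0026).  Lane «TATE-EPC-TC» of cell `bsd-eis`
(crux `GoodLatticeBDPValue`, stmt-BirchSwinnertonDyer-19032), FILE D part 3 = THE DISCHARGE OF `hH2` (the hypothesis of
-w4 g17's FILE C `TateEulerCharacteristicKummerClasses.additive_coindOpen_mu_euler_of_brauerClass`) from a
`LayerPresentation` (FILE D part 2; the instance is (θ-i)-top, -w2 g9 / -w7 g10).

SETTING: as in part 2 (`K` totally complex, `S ⊇ S_p` finite, `H` open with `N_S ≤ H`, `U = galoisGroupAbove S H`,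
`F₀ = baseField H ≤ E.1 ⊆ K_S`, `W = Gal(K_S/E)`, `Δ = ↥U ⧸ W`, `𝓗² = H²(↥U, Maps(Δ, E_S))`, `R = coindOpenHRep … 2`).

* §1 `exists_under_mem` (there is a place of any finite `F/K` above `S ⊇ S_p`), the `p`-torsion coefficients
  `(ℚ/ℤ)[p] = Submodule.torsionBy ℤ (AddCircle 1) p` (`natCard_torsionBy_addCircle`, `finite_torsionBy_addCircle`).
* §2 **`LayerPresentation.exists_torsion_coindInvVec_eq`** — ONTO: every family `a` on the places of `E` above `S`
  with `p • a = 0` and `Σ a = 0` on `S_E` is, on `S_E`, the invariant vector `coindInvVec` of some `y ∈ 𝓗²` with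
  `(p:ℤ) • y = 0` (-w8's REALISATION `exists_layer_realisation` over the cyclotomic layer `exists_cyclotomicLayer`,
  base `E`, pushed through the presentation).
* §3 **`additive_torsion_eq_of_invariantVector`** — the ABSTRACT `θ`-package over an arbitrary `ℤ[Δ]`-module `M`
  (design note: every statement about `𝓗²` enters §4 by name, so that no elaboration step unfolds the cohomology
  group — the direct route times out): from an additive, equivariant, injective, `S_E`-supported, sum-zero and ONTO
  "invariant vector" `c : M → (ι → ℚ/ℤ)` build `θ = c|_{M[p]}` valued in `(ℚ/ℤ)[p]` and apply -w6 g10's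
  `additive_permutation_quotient_comp_eq_add_trivial_of_embedding_onto_sumZero` (the permutation module
  `(τ d f)(x) = f((e d)⁻¹ x)` is a local construction).
* §4 **`additive_torsion_coindOpenHRep_two_of_layerPresentation`** = `hH2` (token for token, `ψ` strict-implicit as in
  FILE C; extra binder: a `LayerPresentation`): `ψ(R|N₂) + ψ(ℤ/p) = ψ(ℤ[placesAbove K S F₀ E]/p ∘ layerEquiv)` for every
  `Δ`-stable `N₂ = {t | (p:ℤ) • t = 0}` — §3 fed with FILE D part 2's `coindInvVec` and §2.

HONEST FRAMING: bookkeeping of landed theorems; conditional on a `LayerPresentation` (hypothesis structure, no named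
fact); no statement of a Summit, of Tate's theorem or of the crux is proved here; 0 cells / labels / tiers move.

## References
* J. Neukirch, A. Schmidt, K. Wingberg, *Cohomology of Number Fields*, 2nd ed. (2008), VIII §3 (8.3.10)–(8.3.11).
  [NeukirchSchmidtWingberg2008]
* J. S. Milne, *Arithmetic Duality Theorems* (2006), I §5, proof of Thm. 5.1 (p. 70). [MilneADT2006]
* J. W. S. Cassels, A. Fröhlich (eds.), *Algebraic Number Theory* (1967), Ch. VII (Tate) §7.3, §11.2. [CasselsFrohlichANT1967]
-/

noncomputable section

open NumberField IsDedekindDomain Field IntermediateField CategoryTheory groupCohomology Function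
open scoped Pointwise
open Literature.NumberTheory.GaloisRepresentations.OpenSubgroupLayer (algOfLE isScalarTower_algOfLE baseField)
open Literature.NumberTheory.GaloisRepresentations.LocalWeilDatum
open Literature.NumberTheory.GaloisRepresentations.IdeleClassBar (GalLayer)
open Literature.NumberTheory.IwasawaTheory.Greenberg2006 (galoisGroupAbove)
open Literature.NumberTheory.NumberFields (EquivariantSUnit.placesAbove EquivariantSUnit.finite_placesAbove
  EquivariantSUnit.mem_placesAbove_iff EquivariantSUnit.coe_smul_placesAbove)
open Literature.RepresentationTheory.FiniteGroups.StableLatticeReduction (smul_top_le_comap)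
open Literature.RepresentationTheory.FiniteGroups.StableLatticeReduction.Int
  (additive_permutation_quotient_comp_eq_add_trivial_of_embedding_onto_sumZero)

namespace Literature.NumberTheory.GaloisRepresentations

namespace SUnits

namespace Layers

variable {K : Type} [Field K] [NumberField K] {S : Set (HeightOneSpectrum (𝓞 K))} {H : Subgroup (absoluteGaloisGroup K)}

/-! ## §1. Places above `S` exist; the coefficients `(ℚ/ℤ)[p]` -/

omit [NumberField K] in
/-- For `S ⊇ S_p` (`p` prime) and any finite extension `F/K`, some place of `F` lies above `S` (a prime of `𝓞 F`
above `p`). [cite: NeukirchANT1999, Ch. I §8] -/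
theorem exists_under_mem {p : ℕ} (hp : p.Prime) (hSp : ∀ v : HeightOneSpectrum (𝓞 K), ((p : ℕ) : 𝓞 K) ∈ v.asIdeal → v ∈ S)
    (F : Type) [Field F] [NumberField F] [Algebra K F] : ∃ w : HeightOneSpectrum (𝓞 F), w.under (𝓞 K) ∈ S := by
  -- a maximal ideal of `𝓞 F` over `(p) ⊆ ℤ`
  haveI : (Ideal.span {(p : ℤ)}).IsMaximal :=
    ((Ideal.span_singleton_prime (by exact_mod_cast hp.ne_zero)).mpr (Nat.prime_iff_prime_int.mp hp)).isMaximal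
      (by simpa using hp.ne_zero)
  obtain ⟨Q, hQmax, hQover⟩ :=
    Ideal.exists_ideal_over_maximal_of_isIntegral (S := 𝓞 F) (Ideal.span {(p : ℤ)}) (by
      rw [(RingHom.injective_iff_ker_eq_bot _).mp (by exact Int.cast_injective)]; exact bot_le)
  have hQ0 : Q ≠ ⊥ := by
    intro h
    have hmem : (p : ℤ) ∈ Q.comap (algebraMap ℤ (𝓞 F)) := by rw [hQover]; exact Ideal.mem_span_singleton_self _
    rw [h, Ideal.mem_comap, Ideal.mem_bot, map_natCast, Nat.cast_eq_zero] at hmem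
    exact hp.ne_zero hmem
  refine ⟨⟨Q, hQmax.isPrime, hQ0⟩, hSp _ ?_⟩
  change ((p : ℕ) : 𝓞 K) ∈ Ideal.comap (algebraMap (𝓞 K) (𝓞 F)) Q
  have hmem : (p : ℤ) ∈ Q.comap (algebraMap ℤ (𝓞 F)) := by rw [hQover]; exact Ideal.mem_span_singleton_self _
  rw [Ideal.mem_comap, map_natCast]
  simpa [Ideal.mem_comap] using hmem

/-- `(ℚ/ℤ)[p]` has `p` elements. [cite: CasselsFrohlichANT1967, Ch. VII §7.3 Cor. 7.4 (b)] -/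
theorem natCard_torsionBy_addCircle {p : ℕ} (hp : p.Prime) :
    Nat.card (Submodule.torsionBy ℤ (AddCircle (1 : ℚ)) (p : ℤ)) = p := by
  refine (Nat.card_congr (Equiv.subtypeEquivRight fun a => ?_)).trans (natCard_addCircle_torsion_eq hp)
  rw [Submodule.mem_torsionBy_iff, natCast_zsmul]

/-- `(ℚ/ℤ)[p]` is finite. [cite: CasselsFrohlichANT1967, Ch. VII §7.3 Cor. 7.4 (b)] -/
theorem finite_torsionBy_addCircle {p : ℕ} (hp : p.Prime) : Finite (Submodule.torsionBy ℤ (AddCircle (1 : ℚ)) (p : ℤ)) :=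
  Nat.finite_of_card_ne_zero (by rw [natCard_torsionBy_addCircle hp]; exact hp.ne_zero)

/-! ## §2. ONTO: every sum-zero `p`-torsion family on the places of `E` above `S` is an invariant vector -/

section Onto

variable [CompactSpace ↥(galoisGroupAbove S H)] {hHo : IsOpen (H : Set (absoluteGaloisGroup K))} {E : GalLayer K}
  {hF : baseField H ≤ E.1} {hS : ramificationSubgroup K S ≤ galFixing K E.1} (L : LayerPresentation hHo E hF hS)
  (S_E : Finset (HeightOneSpectrum (𝓞 ↥E.1))) (hSE : ∀ u : HeightOneSpectrum (𝓞 ↥E.1), u ∈ S_E ↔ u.under (𝓞 K) ∈ S)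

/-- **REALISATION on `𝓗²`**: for `K` totally complex and `S ⊇ S_p`, every family `a` on the places of `E` with
`p • a_v = 0` on `S_E` and `Σ_{v ∈ S_E} a_v = 0` is, on `S_E`, the invariant vector of some `y ∈ 𝓗²` with `(p:ℤ) • y = 0`
(-w8's `exists_layer_realisation` over the cyclotomic layer `exists_cyclotomicLayer`, base `E.1`, pushed through the
presentation; `p • z` dies in a bigger layer, so `(p:ℤ) • y = 0`).
[cite: NeukirchSchmidtWingberg2008, VIII §3 (8.3.11) (ii)/(iii) (proof)][cite: CasselsFrohlichANT1967, Ch. VII §11.2] -/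
theorem LayerPresentation.exists_torsion_coindInvVec_eq [IsTotallyComplex K] {p : ℕ} [hp : Fact p.Prime]
    (hSp : ∀ v : HeightOneSpectrum (𝓞 K), ((p : ℕ) : 𝓞 K) ∈ v.asIdeal → v ∈ S)
    (a : HeightOneSpectrum (𝓞 ↥E.1) → AddCircle (1 : ℚ)) (hap : ∀ v ∈ S_E, p • a v = 0) (hsum : ∑ v ∈ S_E, a v = 0) :
    ∃ y : coindH2 hHo E hF hS, (p : ℤ) • y = 0 ∧ ∀ v ∈ S_E, L.coindInvVec S_E hSE y v = a v := by
  haveI := E.numberField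
  haveI := E.finiteDimensional
  haveI := E.isGalois
  -- the cyclotomic layer `E₁ ⊇ E` with `p ∣ n_v(E₁/E)` on `S_E`
  obtain ⟨E₁, h₁, fd₁, gal₁, hS₁, hdeg⟩ := exists_cyclotomicLayer S p hSp (F₀ := E.1) (E := E.1) le_rfl hS S_E 1
  have hdeg' : letI := algOfLE h₁
      haveI : NumberField ↥E₁ := NumberField.of_module_finite K _
      ∀ v ∈ S_E, p ∣ IdeleCohomology.localDegree (↥E₁) v := fun v hv =>
    (dvd_mul_of_dvd_left (dvd_pow_self p one_ne_zero) _).trans (hdeg v hv)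
  -- realise `a` in a layer `E' ⊇ E₁`, with `p • z` dying in `E''`
  obtain ⟨E', fd', gal', hEE', hS', z, hz, E'', fd'', gal'', hE'E'', hS'', hpz⟩ :=
    exists_layer_realisation S h₁ hS₁ S_E hSE p hdeg' a hap hsum
  let E'g : GalLayer K := ⟨E', fd', gal'⟩
  let E''g : GalLayer K := ⟨E'', fd'', gal''⟩
  have hEg : E ≤ E'g := h₁.trans hEE'
  have hE'E''g : E'g ≤ E''g := hE'E''
  refine ⟨L.toCoind E'g hEg hS' z, ?_, fun v hv => ?_⟩
  · rw [← map_zsmul, natCast_zsmul, ← L.toCoind_layerInf E'g E''g hEg hE'E''g hS' hS'']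
    change L.toCoind E''g (hEg.trans hE'E''g) hS'' (layerInf S (h₁.trans hEE') hE'E'' 2 (p • z)) = 0
    rw [hpz, map_zero]
  · rw [L.coindInvVec_eq S_E hSE hEg hS' z, invVec_apply]
    convert hz v hv using 2

end Onto

/-! ## §3. The abstract `θ`-package (arbitrary `ℤ[Δ]`-module: nothing about `𝓗²` is unfolded) -/

section Abstract

variable {A : Type*} [AddCommGroup A] {p : ℕ}

/-- **THE ABSTRACT `θ`-PACKAGE** (everything about `𝓗²` that §4 uses, over an ARBITRARY `ℤ[Δ]`-module `M` — so that no
elaboration step ever unfolds the cohomology group).  Data: `e : Δ →* Γ`, `Γ` acting on `ι` with a finite nonempty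
sub-`Γ`-set `T` listed by the finset `S_E`; a `ℤ[Δ]`-module `R` on `M` with finite `Δ`-stable `N₂ = M[p]`; an additive
`c : M → (ι → ℚ/ℤ)` ("invariant vector") with `c(R_d y)(w) = c(y)((e d)⁻¹ w)`, injective, supported on `S_E`, sum-zero,
and realising every sum-zero `p`-torsion family on `S_E` by a `p`-torsion element.  Then for every additive invariant
`ψ` of finite `p`-torsion `ℤ[Δ]`-modules: `ψ(N₂) + ψ(ℤ/p) = ψ(ℤ[T]/p ∘ e)` — -w6 g10's package
`additive_permutation_quotient_comp_eq_add_trivial_of_embedding_onto_sumZero` fed with `θ = c|_{N₂}` valued in `(ℚ/ℤ)[p]`.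
[cite: MilneADT2006, I §5, proof of Thm. 5.1 (p. 70)][cite: NeukirchSchmidtWingberg2008, VIII §3 (8.3.11) (ii)/(iii)] -/
theorem additive_torsion_eq_of_invariantVector [hp : Fact p.Prime] {Δ Γ : Type} [Group Δ] [Group Γ] (e : Δ →* Γ)
    {ι : Type} [MulAction Γ ι] (T : SubMulAction Γ ι) [Fintype ↥T] (hne : Nonempty ↥T) (S_E : Finset ι)
    (hmemS : ∀ w, w ∈ S_E ↔ w ∈ T) {M : Type} [AddCommGroup M] [Module ℤ M] (R : Representation ℤ Δ M)
    (N₂ : Submodule ℤ M) (hN₂ : ∀ t, t ∈ N₂ ↔ (p : ℤ) • t = 0) (hN₂st : ∀ d, N₂ ≤ N₂.comap (R d)) [Finite N₂]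
    (c : M → ι → AddCircle (1 : ℚ)) (hc_add : ∀ y y', c (y + y') = c y + c y')
    (hc_st : ∀ d y w, c (R d y) w = c y ((e d)⁻¹ • w)) (hc_inj : Injective c)
    (hc_off : ∀ y, ∀ w ∉ S_E, c y w = 0) (hc_sum : ∀ y, ∑ w ∈ S_E, c y w = 0)
    (hc_onto : ∀ a : ι → AddCircle (1 : ℚ), (∀ v ∈ S_E, p • a v = 0) → ∑ v ∈ S_E, a v = 0 →
      ∃ y : M, (p : ℤ) • y = 0 ∧ ∀ v ∈ S_E, c y v = a v)
    (ψ : ∀ ⦃X : Type⦄ ⦃_ : AddCommGroup X⦄ ⦃_ : Module ℤ X⦄, Representation ℤ Δ X → A)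
    (hψ : ∀ ⦃X Y Z : Type⦄ [AddCommGroup X] [Module ℤ X] [AddCommGroup Y] [Module ℤ Y]
      [AddCommGroup Z] [Module ℤ Z] (ρX : Representation ℤ Δ X) (ρY : Representation ℤ Δ Y)
      (ρZ : Representation ℤ Δ Z) (f : X →ₗ[ℤ] Y) (g : Y →ₗ[ℤ] Z),
      (∀ s x, f (ρX s x) = ρY s (f x)) → (∀ s y, g (ρY s y) = ρZ s (g y)) →
      Injective f → Surjective g → LinearMap.range f = LinearMap.ker g → Finite Y →
      (∀ y : Y, (p : ℤ) • y = 0) → ψ ρY = ψ ρX + ψ ρZ) :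
    ψ (R.subrepresentation N₂ hN₂st) +
        ψ ((Representation.trivial ℤ Δ ℤ).quotient ((p : ℤ) • ⊤) (smul_top_le_comap _ (p : ℤ))) =
      ψ (Representation.quotient ((Representation.ofMulAction ℤ Γ ↥T).comp e) ((p : ℤ) • ⊤)
        (smul_top_le_comap _ (p : ℤ))) := by
  classical
  haveI : Finite (Submodule.torsionBy ℤ (AddCircle (1 : ℚ)) (p : ℤ)) := finite_torsionBy_addCircle hp.out
  have hT : ∀ (g : Γ) (x : ↥T), ((g • x : ↥T) : ι) = g • (x : ι) := fun _ _ => rfl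
  have hsub : ∀ (d : Δ) (y : N₂), ((R.subrepresentation N₂ hN₂st d y : N₂) : M) = R d (y : M) := fun _ _ => rfl
  let cHom : M →+ (ι → AddCircle (1 : ℚ)) := AddMonoidHom.mk' c hc_add
  -- the permutation module `τ` on `Maps(T, (ℚ/ℤ)[p])`: `(τ d f)(x) = f ((e d)⁻¹ x)` (the `τ` of -w6 g10's package)
  let τ : Representation ℤ Δ (↥T → Submodule.torsionBy ℤ (AddCircle (1 : ℚ)) (p : ℤ)) :=
    { toFun := fun d => (AddMonoidHom.mk' (fun f : ↥T → Submodule.torsionBy ℤ (AddCircle (1 : ℚ)) (p : ℤ) =>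
          fun x => f ((e d)⁻¹ • x)) fun _ _ => rfl).toIntLinearMap
      map_one' := by
        refine LinearMap.ext fun f => funext fun x => ?_
        change f ((e 1)⁻¹ • x) = f x
        rw [map_one, inv_one, one_smul]
      map_mul' := fun d d' => by
        refine LinearMap.ext fun f => funext fun x => ?_
        change f ((e (d * d'))⁻¹ • x) = f ((e d')⁻¹ • (e d)⁻¹ • x)
        rw [map_mul, mul_inv_rev, mul_smul] }
  have hτ : ∀ (d : Δ) (f : ↥T → Submodule.torsionBy ℤ (AddCircle (1 : ℚ)) (p : ℤ)) (x : ↥T),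
      τ d f x = f ((e d)⁻¹ • x) := fun _ _ _ => rfl
  -- `c|_{N₂}` takes values in `(ℚ/ℤ)[p]`
  have hmem : ∀ (x : ↥T) (y : N₂), (Pi.evalAddMonoidHom (fun _ : ι => AddCircle (1 : ℚ)) (x : ι)).comp
      (cHom.comp N₂.subtype.toAddMonoidHom) y ∈ Submodule.torsionBy ℤ (AddCircle (1 : ℚ)) (p : ℤ) := fun x y => by
    have h := map_zsmul cHom (p : ℤ) (y : M)
    rw [(hN₂ _).1 y.2, map_zero] at h
    exact (Submodule.mem_torsionBy_iff _ _).2 (congrFun h (x : ι)).symm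
  -- `θ = c|_{N₂} : N₂ → Maps(T, (ℚ/ℤ)[p])`, additive, hence `ℤ`-linear for the submodule structure of `N₂`
  let θ₀ : N₂ →+ (↥T → Submodule.torsionBy ℤ (AddCircle (1 : ℚ)) (p : ℤ)) :=
    AddMonoidHom.pi fun x => AddMonoidHom.codRestrict
      ((Pi.evalAddMonoidHom (fun _ : ι => AddCircle (1 : ℚ)) (x : ι)).comp (cHom.comp N₂.subtype.toAddMonoidHom))
      (Submodule.torsionBy ℤ (AddCircle (1 : ℚ)) (p : ℤ)) (hmem x)
  letI hmod : Module ℤ N₂ := N₂.module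
  let θ : N₂ →ₗ[ℤ] (↥T → Submodule.torsionBy ℤ (AddCircle (1 : ℚ)) (p : ℤ)) :=
    { toFun := θ₀, map_add' := θ₀.map_add, map_smul' := fun n y => map_intCast_smul θ₀ ℤ ℤ n y }
  have hθ : ∀ (y : N₂) (x : ↥T),
      ((θ y x : Submodule.torsionBy ℤ (AddCircle (1 : ℚ)) (p : ℤ)) : AddCircle (1 : ℚ)) = c (y : M) (x : ι) :=
    fun _ _ => rfl
  -- equivariance
  have hequiv : ∀ (d : Δ) (y : N₂), θ (R.subrepresentation N₂ hN₂st d y) = τ d (θ y) := fun d y => by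
    funext x
    apply Subtype.ext
    rw [hθ, hsub, hτ, hθ, hT]
    exact hc_st d (y : M) (x : ι)
  -- injectivity
  have hinj : Injective θ := fun y y' h => by
    apply Subtype.ext
    apply hc_inj
    funext w
    by_cases hw : w ∈ S_E
    · have h1 := congrArg (fun g : ↥T → Submodule.torsionBy ℤ (AddCircle (1 : ℚ)) (p : ℤ) =>
        ((g ⟨w, (hmemS w).1 hw⟩ : Submodule.torsionBy ℤ (AddCircle (1 : ℚ)) (p : ℤ)) : AddCircle (1 : ℚ))) h
      simpa only [hθ] using h1
    · rw [hc_off _ _ hw, hc_off _ _ hw]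
  -- sum zero
  have hsum : ∀ y : N₂, ∑ x, θ y x = 0 := fun y => by
    apply Subtype.ext
    rw [Submodule.coe_sum, Submodule.coe_zero]
    have h := hc_sum (y : M)
    rw [Finset.sum_subtype S_E hmemS] at h
    simpa only [hθ] using h
  -- onto the sum-zero functions
  have hsurj : ∀ f : ↥T → Submodule.torsionBy ℤ (AddCircle (1 : ℚ)) (p : ℤ), ∑ x, f x = 0 → ∃ y : N₂, θ y = f :=
      fun f hf => by
    let a : ι → AddCircle (1 : ℚ) := fun w =>
      if hw : w ∈ T then ((f ⟨w, hw⟩ : Submodule.torsionBy ℤ (AddCircle (1 : ℚ)) (p : ℤ)) : AddCircle (1 : ℚ)) else 0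
    have ha : ∀ x : ↥T, a (x : ι) = ((f x : Submodule.torsionBy ℤ (AddCircle (1 : ℚ)) (p : ℤ)) : AddCircle (1 : ℚ)) :=
      fun x => by
      change (if hw : (x : ι) ∈ T then _ else _) = _
      rw [dif_pos x.2]
    have hap : ∀ v ∈ S_E, p • a v = 0 := fun v hv => by
      rw [ha ⟨v, (hmemS v).1 hv⟩, ← natCast_zsmul]
      exact (Submodule.mem_torsionBy_iff _ _).1 (f ⟨v, (hmemS v).1 hv⟩).2
    have hsum' : ∑ v ∈ S_E, a v = 0 := by
      rw [Finset.sum_subtype S_E hmemS a]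
      have hf' := congrArg (fun t : Submodule.torsionBy ℤ (AddCircle (1 : ℚ)) (p : ℤ) => (t : AddCircle (1 : ℚ))) hf
      simp only [Submodule.coe_sum, Submodule.coe_zero] at hf'
      rw [← hf']
      exact Finset.sum_congr rfl fun x _ => ha x
    obtain ⟨y, hy, hyv⟩ := hc_onto a hap hsum'
    refine ⟨⟨y, (hN₂ _).2 hy⟩, funext fun x => Subtype.ext ?_⟩
    rw [hθ, ← ha x]
    exact hyv (x : ι) ((hmemS _).2 x.2)
  -- the package
  symm
  exact additive_permutation_quotient_comp_eq_add_trivial_of_embedding_onto_sumZero ψ hψ e ↥T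
    (natCard_torsionBy_addCircle hp.out) τ hτ (R.subrepresentation N₂ hN₂st) θ hequiv hinj hne hsurj hsum

end Abstract

/-! ## §4. `hH2`: the `Δ`-class of `𝓗²(E_S)[p]` -/

section Main

variable {A : Type*} [AddCommGroup A] {p : ℕ}

/-- **`ψ(𝓗²(E_S)[p]) + ψ(ℤ/p) = ψ(ℤ[S(E)]/p ∘ layerEquiv)`** — the hypothesis `hH2` of FILE C
(`additive_coindOpen_mu_euler_of_brauerClass`), from a layer presentation of `𝓗² = H²(↥U, Maps(Δ, E_S))`: the invariant
vector `θ = coindInvVec` (FILE D part 2: additive, `Δ`-equivariant, injective, supported on `S_E`, sum-zero) and the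
REALISATION of §2 feed the abstract package `additive_torsion_eq_of_invariantVector`.
[cite: NeukirchSchmidtWingberg2008, VIII §3 (8.3.11) (ii)/(iii)][cite: MilneADT2006, I §5, proof of Thm. 5.1 (p. 70)] -/
theorem additive_torsion_coindOpenHRep_two_of_layerPresentation [IsTotallyComplex K]
    (hHo : IsOpen (H : Set (absoluteGaloisGroup K))) (hNH : ramificationSubgroup K S ≤ H) (hfin : S.Finite)
    (E : GalLayer K) (hF : baseField H ≤ E.1) (hS : ramificationSubgroup K S ≤ galFixing K E.1) [hp : Fact p.Prime]
    (hSp : ∀ v : HeightOneSpectrum (𝓞 K), ((p : ℕ) : 𝓞 K) ∈ v.asIdeal → v ∈ S)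
    [CompactSpace ↥(galoisGroupAbove S H)] [NumberField ↥(baseField H)] (L : LayerPresentation hHo E hF hS)
    (ψ : ∀ ⦃X : Type⦄ ⦃_ : AddCommGroup X⦄ ⦃_ : Module ℤ X⦄,
      Representation ℤ (↥(galoisGroupAbove S H) ⧸ ((OpenSubgroupLayer.layerSubgroup S hHo E hF hS : OpenNormalSubgroup ↥(galoisGroupAbove S H)) :
        Subgroup ↥(galoisGroupAbove S H))) X → A)
    (hψ : ∀ ⦃X Y Z : Type⦄ [AddCommGroup X] [Module ℤ X] [AddCommGroup Y] [Module ℤ Y]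
      [AddCommGroup Z] [Module ℤ Z] (ρX : Representation ℤ (↥(galoisGroupAbove S H) ⧸ ((OpenSubgroupLayer.layerSubgroup S hHo E hF hS : OpenNormalSubgroup ↥(galoisGroupAbove S H)) :
        Subgroup ↥(galoisGroupAbove S H))) X)
      (ρY : Representation ℤ (↥(galoisGroupAbove S H) ⧸ ((OpenSubgroupLayer.layerSubgroup S hHo E hF hS : OpenNormalSubgroup ↥(galoisGroupAbove S H)) :
        Subgroup ↥(galoisGroupAbove S H))) Y)
      (ρZ : Representation ℤ (↥(galoisGroupAbove S H) ⧸ ((OpenSubgroupLayer.layerSubgroup S hHo E hF hS : OpenNormalSubgroup ↥(galoisGroupAbove S H)) :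
        Subgroup ↥(galoisGroupAbove S H))) Z) (f : X →ₗ[ℤ] Y) (g : Y →ₗ[ℤ] Z),
      (∀ s x, f (ρX s x) = ρY s (f x)) → (∀ s y, g (ρY s y) = ρZ s (g y)) →
      Injective f → Surjective g → LinearMap.range f = LinearMap.ker g → Finite Y →
      (∀ y : Y, (p : ℤ) • y = 0) → ψ ρY = ψ ρX + ψ ρZ)
    (N₂ : Submodule ℤ (continuousCohomology 2 ((resRep K S H).coindOpen
      ((OpenSubgroupLayer.layerSubgroup S hHo E hF hS : OpenNormalSubgroup ↥(galoisGroupAbove S H)) :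
        Subgroup ↥(galoisGroupAbove S H))
      (OpenSubgroupLayer.layerSubgroup S hHo E hF hS).isOpen').toTopRep)) (hN₂ : ∀ t, t ∈ N₂ ↔ (p : ℤ) • t = 0)
    (hN₂st : ∀ d, N₂ ≤ N₂.comap ((resRep K S H).coindOpenHRep (((OpenSubgroupLayer.layerSubgroup S hHo E hF hS : OpenNormalSubgroup ↥(galoisGroupAbove S H)) :
        Subgroup ↥(galoisGroupAbove S H))) (OpenSubgroupLayer.layerSubgroup S hHo E hF hS).isOpen' 2 d)) :
    letI := algOfLE hF
    haveI := E.numberField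
    ψ (((resRep K S H).coindOpenHRep (((OpenSubgroupLayer.layerSubgroup S hHo E hF hS : OpenNormalSubgroup ↥(galoisGroupAbove S H)) :
        Subgroup ↥(galoisGroupAbove S H))) (OpenSubgroupLayer.layerSubgroup S hHo E hF hS).isOpen' 2).subrepresentation N₂ hN₂st) +
        ψ ((Representation.trivial ℤ (↥(galoisGroupAbove S H) ⧸ ((OpenSubgroupLayer.layerSubgroup S hHo E hF hS : OpenNormalSubgroup ↥(galoisGroupAbove S H)) :
        Subgroup ↥(galoisGroupAbove S H))) ℤ).quotient ((p : ℤ) • ⊤)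
          (smul_top_le_comap _ (p : ℤ))) =
      ψ (Representation.quotient ((Representation.ofMulAction ℤ (↥E.1 ≃ₐ[↥(baseField H)] ↥E.1)
           (EquivariantSUnit.placesAbove K S ↥(baseField H) ↥E.1)).comp
           (OpenSubgroupLayer.layerEquiv S hHo E hF hS).toMonoidHom) ((p : ℤ) • ⊤)
           (smul_top_le_comap _ (p : ℤ))) := by
  letI := algOfLE hF
  haveI := E.numberField
  haveI := E.finiteDimensional
  haveI := E.isGalois
  -- the finite set `S_E` of places of `E` above `S` (as `Exists.choose`: the goal carries local instances)
  have hSE : ∀ u : HeightOneSpectrum (𝓞 ↥E.1), u ∈ (exists_finset_mem_iff_under_mem S hfin ↥E.1).choose ↔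
      u.under (𝓞 K) ∈ S := (exists_finset_mem_iff_under_mem S hfin ↥E.1).choose_spec
  have hmemS : ∀ w, w ∈ (exists_finset_mem_iff_under_mem S hfin ↥E.1).choose ↔
      w ∈ EquivariantSUnit.placesAbove K S ↥(baseField H) ↥E.1 := fun w =>
    (hSE w).trans (EquivariantSUnit.mem_placesAbove_iff w).symm
  haveI : Finite (EquivariantSUnit.placesAbove K S ↥(baseField H) ↥E.1) := EquivariantSUnit.finite_placesAbove hfin
  letI : Fintype (EquivariantSUnit.placesAbove K S ↥(baseField H) ↥E.1) := Fintype.ofFinite _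
  have hne : Nonempty (EquivariantSUnit.placesAbove K S ↥(baseField H) ↥E.1) := by
    have h := exists_under_mem hp.out hSp ↥E.1
    exact ⟨⟨h.choose, (EquivariantSUnit.mem_placesAbove_iff _).2 h.choose_spec⟩⟩
  haveI : Finite N₂ := by
    have hfin₂ := finite_torsion_continuousCohomology_two_coindOpen_layer hHo hNH hfin E hF hS hp.out.pos
    refine Set.Finite.to_subtype (hfin₂.subset fun y hy => ?_)
    change p • y = 0
    rw [← natCast_zsmul]
    exact (hN₂ y).1 hy
  exact additive_torsion_eq_of_invariantVector (OpenSubgroupLayer.layerEquiv S hHo E hF hS).toMonoidHom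
    (EquivariantSUnit.placesAbove K S ↥(baseField H) ↥E.1) hne _ hmemS
    ((resRep K S H).coindOpenHRep _ (OpenSubgroupLayer.layerSubgroup S hHo E hF hS).isOpen' 2) N₂ hN₂ hN₂st
    (L.coindInvVec _ hSE) (L.coindInvVec_add _ hSE) (fun d y w => L.coindInvVec_coindOpenHRep _ hSE d y w)
    (L.coindInvVec_injective _ hSE)
    (fun y _ hw => L.coindInvVec_eq_zero_of_not_mem _ hSE y hw) (fun y => L.sum_coindInvVec_eq_zero _ hSE y)
    (fun a hap hsum => L.exists_torsion_coindInvVec_eq _ hSE hSp a hap hsum) ψ hψ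

end Main

end Layers

end SUnits

end Literature.NumberTheory.GaloisRepresentations

end
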